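import Summits.FinalStateConjecture.FinalStateConjecture.Theorems.StarvedNecksHonestFixedRadiusSettlingSurgeryLine
import Summits.FinalStateConjecture.FinalStateConjecture.Theorems.StarvedNecksHonestFixedRadiusSettlingSurgeryLineGrowing
import Summits.FinalStateConjecture.FinalStateConjecture.Theorems.StarvedNecksHonestFixedRadiusSettlingStubBreathingProbe

/-!
# Negative side of crux `StarvedNecks.HonestFixedRadiusSettling` (stmt-FinalStateConjecture-13550):
# the deep-burial regime of `stub_stableUnfoldingGrowing` is SwallowTheDatum's burial (probe and threshold idle)

Disprover file (cdisprove generation 4, 2026-08-16), companion of `StableUnfoldingPoison.lean` (p122095): the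
second half of the `η`-DICHOTOMY of the registered stub D″ `stub_stableUnfoldingGrowing` of line
`far-field-surgery` (skeleton `4a983fe8fc73`; second hypothesis of
`FarFieldSurgery.honestFixedRadiusSettling_of_farAnnulusGluing`, p121008).

* Small `η`: D″ is false on paper (`stableUnfoldingGrowing_false_of_poison`: poisoned growing far families).
* `η > 64` (this file, `stableUnfoldingGrowing64_of_burial`): the statement of D″ WITH the extra hypothesis
  `64 < η` follows — with the CONSTANT threshold `ρ ≡ 0` and the landed breathing probe, i.e. with unfolding,
  marker and threshold all IDLE — from one hypothesis about data alone, BURIAL: every admissible datum that is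
  exactly time-symmetric isotropic Schwarzschild(`M`) beyond a chart radius `ϱ < M / 2` lies in
  `Negative.coreSet X`.  Indeed `m R ≥ ηR > 64R` gives `32R < m R / 2`, so every patched member `S (R, t)`
  (`= G R` on `e.far R₀ ⊇ {32R < ‖x‖}`) is exactly Schwarzschild(`m R`) from INSIDE its throat `‖x‖ = m R / 2`
  outward: the throat is a minimal sphere with `k = 0` (marginally trapped), the spheres just inside it are
  trapped, and the datum `d`, the probe and the whole gluing annulus lie below them; the domain of outer
  communication of any development is `D⁺`(exterior sheet) = Kruskal region I, whatever the interior does.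
  BURIAL is the honest-`C⁴`/one-atlas form of SwallowTheDatum's `SheetShieldedSettles` (stmt-15428) and of the
  crux cards bury-it-honestly / inherit-the-burial-exact-kerr-honesty (`KerrShieldedHonest`): true on paper
  (modulo MGHD existence), not far-field surgery.

So NO regime of the growing schedule carries this line's own mechanism: where D″ is not poisoned it is burial.
References: Mao–Oh–Tao arXiv:2308.13031 Thm 1.7/1.10; Li–Mei arXiv:2005.01249 §2.2; Hawking–Ellis (1973)
Prop. 9.2.1; `Theses/SwallowTheDatum.lean` (15427, 15428); Dafermos–Luk arXiv:1710.01722, Conjecture 1.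
-/

-- the doubled `FinalStateConjecture` path component is the summit/problem naming scheme, not a mistake
set_option linter.dupNamespace false

noncomputable section

namespace Summit.FinalStateConjecture.FinalStateConjecture.Theorems.HonestFixedRadiusSettling.Negative

open scoped Manifold ContDiff Topology
open Set Filter Function Literature.Geometry.Lorentzian
open Summit.FinalStateConjecture.FinalStateConjecture.Theorems.SwallowTheDatum.ParametricKerrBurial
  (SmoothSectionsOn AgreeAt IsExactSchwarzschildBeyond)
open Summit.FinalStateConjecture.FinalStateConjecture.Theorems.StarvedNecks.FarFieldSurgery
  (exists_breathingProbe hCoeff_kCoeff_congr_of_agree_far)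

/-- **THE DEEP-BURIAL REGIME OF D″ IS BURIAL.**  Hypothesis BURIAL (`hburial`, data-level, unregistered;
the honest-`C⁴`/one-atlas form of SwallowTheDatum's `SheetShieldedSettles`, stmt-15428): every admissible datum
exactly time-symmetric isotropic Schwarzschild(`M`) beyond a chart radius `ϱ < M / 2` (so from inside the throat
`‖x‖ = M / 2` outward) lies in `Negative.coreSet X`.  Conclusion: the registered stub `stub_stableUnfoldingGrowing`
(statement verbatim) WITH the extra hypothesis `64 < η`, proved with the constant threshold `ρ ≡ 0` and the
LANDED breathing probe `exists_breathingProbe` (any probe would do): for `R > R⋆ > e.R > 0`,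
`m R ≥ ηR > 64R` gives `32R < m R / 2`, and the patched member `S (R, t)`, equal to `G R` on
`e.far R₀ ⊇ {32R < ‖x‖}` (`hCoeff_kCoeff_congr_of_agree_far`), is exactly Schwarzschild(`m R`) beyond `32R`;
BURIAL applies.  Unfolding, marker and threshold are idle: in this regime D″ is not far-field surgery.  Together
with `stableUnfoldingGrowing_false_of_poison` (small `η`) this is the `η`-dichotomy of D″.
Li–Mei arXiv:2005.01249 §2.2 (sheet shielding); Hawking–Ellis 1973, Prop. 9.2.1. [cite: LiMei2020, §2.2] -/
theorem stableUnfoldingGrowing64_of_burial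
    (hburial : ∀ (X : Type) [TopologicalSpace X] [ChartedSpace E3 X] [IsManifold (𝓡 3) ∞ X] [T2Space X]
        [SecondCountableTopology X] [ConnectedSpace X], ∀ D ∈ admissibleVacuumData X,
        ∀ (e : AFEnd X) (M ϱ : ℝ), ϱ < M / 2 → IsExactSchwarzschildBeyond e D M ϱ → D ∈ coreSet X) :
    ∀ (X : Type) [TopologicalSpace X] [ChartedSpace E3 X] [IsManifold (𝓡 3) ∞ X] [T2Space X]
      [SecondCountableTopology X] [ConnectedSpace X], ∀ d ∈ admissibleVacuumData X,
      ∀ (η : ℝ) (e : AFEnd X) (Rstar : ℝ) (m : ℝ → ℝ) (G : ℝ → InitialDataSet (𝓡 3) X),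
        64 < η → 0 < η → e.IsSoleEnd → e.R < Rstar → ContDiff ℝ ∞ m →
        SmoothSectionsOn 𝓘(ℝ, ℝ) G {p : ℝ × X | Rstar < p.1} →
        (∀ R : ℝ, Rstar < R → G R ∈ admissibleVacuumData X ∧ (∀ x ∉ e.far R, AgreeAt (G R) d x) ∧
          η * R ≤ m R ∧ IsExactSchwarzschildBeyond e (G R) (m R) (32 * R)) →
        ∃ (R₀ : ℝ) (E : ℝ → InitialDataSet (𝓡 3) X) (x₀ : X) (v₀ : TangentSpace (𝓡 3) x₀),
          e.R < R₀ ∧ R₀ < Rstar ∧ SmoothSectionsOn 𝓘(ℝ, ℝ) E (Set.univ : Set (ℝ × X)) ∧ E 0 = d ∧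
          (∀ t : ℝ, E t ∈ admissibleVacuumData X) ∧ (∀ t : ℝ, ∀ x ∈ e.far R₀, AgreeAt (E t) d x) ∧
          x₀ ∉ e.far R₀ ∧ Set.InjOn (fun t : ℝ ↦ (E t).h.inner x₀ v₀ v₀) (Set.Ioo (-1) 1) ∧
          ∀ S : ℝ × ℝ → InitialDataSet (𝓡 3) X,
            SmoothSectionsOn (𝓘(ℝ, ℝ).prod 𝓘(ℝ, ℝ)) S {p : (ℝ × ℝ) × X | Rstar < p.1.1} →
            (∀ R t : ℝ, Rstar < R →
              S (R, t) ∈ admissibleVacuumData X ∧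
              (∀ x ∉ e.far R, AgreeAt (S (R, t)) (E t) x) ∧
              (∀ x ∈ e.far R₀, AgreeAt (S (R, t)) (G R) x)) →
            ∃ ρ : ℝ → ℝ, ContinuousOn ρ {t : ℝ | t ≠ 0} ∧
              ∀ R t : ℝ, Rstar < R → ρ t ≤ R → t ≠ 0 → |t| < 1 → S (R, t) ∈ coreSet X := by
  intro X _ _ _ _ _ _ d hd η e Rstar m G h64 _ _ heR _ _ hGmem
  -- the probe radius: midway in the shell `(e.R, R⋆)`
  set R₀ : ℝ := (e.R + Rstar) / 2 with hR₀_def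
  have hR₀ : e.R < R₀ := by rw [hR₀_def]; linarith
  have hR₀s : R₀ < Rstar := by rw [hR₀_def]; linarith
  obtain ⟨E, x₀, v₀, hEs, hE0, hEadm, hEd, hx₀, hmark⟩ := exists_breathingProbe X d e R₀ hd hR₀
  refine ⟨R₀, E, x₀, v₀, hR₀, hR₀s, hEs, hE0, hEadm, hEd, hx₀, hmark, fun S _ hS ↦ ?_⟩
  refine ⟨fun _ ↦ 0, continuousOn_const, fun R t hR _ _ _ ↦ ?_⟩
  obtain ⟨hadm, -, hSG⟩ := hS R t hR
  obtain ⟨-, -, hmass, hexact⟩ := hGmem R hR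
  have hRpos : 0 < R := e.R_pos.trans (hR₀.trans (hR₀s.trans hR))
  refine hburial X (S (R, t)) hadm e (m R) (32 * R) ?_ fun x hx ↦ ?_
  · -- deep burial: `32 R < m R / 2` from `η R ≤ m R`, `64 < η`, `0 < R`
    nlinarith
  · -- the exact zone of `G R` is read on `e.far R₀ ⊇ {32 R < ‖x‖}`, where `S (R, t) = G R`
    have hx' : R₀ < ‖x‖ := by nlinarith [hR₀s.trans hR]
    obtain ⟨hh, hk⟩ := hCoeff_kCoeff_congr_of_agree_far e hR₀ hSG hx'
    rw [hh, hk]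
    exact hexact x hx

end Summit.FinalStateConjecture.FinalStateConjecture.Theorems.HonestFixedRadiusSettling.Negative

end
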